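import Mathlib
import Literature.MathematicalPhysics.QuantumFieldTheory.Balaban1983to89.B15HDecayLeaves
import Literature.MathematicalPhysics.QuantumFieldTheory.Balaban1983to89.B16Sect1Statements
import Literature.MathematicalPhysics.QuantumFieldTheory.Balaban1983to89.B15LayerSupSize
import Literature.MathematicalPhysics.QuantumFieldTheory.Balaban1983to89.B11SeminormSize190
import Literature.MathematicalPhysics.QuantumFieldTheory.Balaban1983to89.B11Ineq190Actual

/-!
# `Balaban1983to89.B16Ineq123From190` — [Balaban1989LargeFieldII] (1.23) p. 362 «L^jη|𝐇_{𝐁₁}|, (L^jη)²|∇^η_{U⁰(𝐁₁)}𝐇_{𝐁₁}| <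
# B₃exp(−δMR_{h+1})11d²(1+β₀)²R_k^{β₀}ε_k on Ω″_j ∩ Ω^c_k» DERIVED FROM [15] (190): the typed leaf `B16Sect1Statements.Ineq123`
# (row B16.Eq1.23) from the (190) record on the derivative family, (2.61), the localisation of the argument field in the boundary
# layer at `∂Ω″~²_{h+1}` with its printed size `11d²ε_h`, the mean-value domination and the printed chain `ε_h ≤ (1+β₀)²N^{β₀}ε_k`,
# `N ≤ R_k` — the B16 twin of r12's [IV] (1.57)/(1.58)/(1.90) knits (`B15HDecayLeaves`, `B15Ineq158Bound`); and the same ON THE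
# LATTICE with all sizes concrete (`B15LayerSupSize`/`B15LayerLocal` layer field, `B11SupSize190`/`B11SeminormSize190` output sizes)

statement-level skeleton of published theorems with citation tags; proofs where landed; nothing here is a claim about
the Yang–Mills mass gap.

CITATION HEADER (lean-in-tree rule 2026-08-18).  T. Bałaban, *Large field renormalization. II. Localization, exponentiation, and
bounds for the 𝐑 operation*, Commun. Math. Phys. **122**, 355–392 (1989), doi:10.1007/BF01238433, bib `Balaban1989LargeFieldII` (cell
paper B16; PDF held `paper:balaban1989-cmp122-large-field-ii`, journal page = PDF page + 354; pp. 361–362 = PDF 7–8 READ by this seat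
from the held text layer, `lit read … --pages 7-9`, 2026-08-21).  "[15]" = [Balaban1985Variational] (190) p. 308 (`B11SectG.Ineq190`);
"[3]" = [Balaban1984PropagatorsII] (2.61) p. 234 (`B11SectG.RowSum`); "[IV]" = [Balaban1989LargeFieldI] (1.90)/(1.96) pp. 198–199;
"[III]" = [Balaban1988Convergent] §2.  WHAT IS REPRODUCED: SKELETON row **B16.Eq1.23** (owner r13, `lit-balaban-r13/ROWS-B16.md`; leaf
`B16Sect1Statements.Ineq123`, r13 gen 2; r13's `SURVEY-B16-remaining.md` §B: *«deriving it BY NAME from r08's (190) record would follow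
r12's route for [IV] (1.57)/(1.58) … the only honest upgrade path»*).  Unit `lit-balaban-p29` gen 9 (Phase-2 free target, G.5-34(d)),
HOME `run/shared/lean/pub/lit-balaban/`.

THE PRINTED TEXT (pp. 361–362 [PDF 7–8], verbatim from the held text; two words corrected against the p. 361 IMAGE by the second
reader r16 g8, `ROWS-B16-secondread.md` addendum 5 — «𝐁_h(Ω″~²_{h+1})», «U⁰_{k,Z}» — v1.2): *«We introduce the determining set 𝐁₁ = 𝐁″_k(Z) ∪ 𝐁_h(Ω″~²_{h+1}),
… and we take the corresponding function U_{𝐁₁}. … The argument of the function 𝐇_{𝐁₁} has a support in the boundary layer of the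
width 2M₁ (in the L^{−h}-scale), at the boundary ∂Ω″~²_{h+1}. The configuration U⁰_{k,Z} satisfies the regularity condition (1.96) [IV]
on (Ω″~_{h+1})^c ∩ Ω_h. In fact by the same argument as the one leading to (1.96) [IV], we have to forget only about the field B′ in
the bounds. By the usual reasoning the field in the argument of the function 𝐇_{𝐁₁} can be bounded by 11d²ε_h ≦ 11d²(1 + β₀)²N^{β₀}ε_k
≦ 11d²(1 + β₀)²R_k^{β₀}ε_k, hence L^jη|𝐇_{𝐁₁}|, (L^jη)²|∇^η_{U⁰(𝐁₁)}𝐇_{𝐁₁}| < B₃exp(−δMR_{h+1})11d²(1 + β₀)²R_k^{β₀}ε_k (1.23) on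
Ω″_j ∩ Ω^c_k, for j = h + 1, …, k.»*

THE MECHANISM (= r12's reading of every such sentence of [IV], `B15HDecayLeaves`): (190) of [15] bounds the base-point DERIVATIVES
`(δ/δB)𝓗` with the kernel `C·exp(−⅛δ₀d(y,y′))` between the input size `bB` of the argument field and an output size `bout`; with
(2.61) at rate `σ`, a rate `τ ≥ 0`, `σ + τ ≤ ⅛δ₀`, an argument field of B-size `≤ m` vanishing on the blocks `y′` with `d(y,y′) < D`
and the mean-value domination `hmv`, `bout.loc y 𝓗(B) ≤ Cκ_Bc·m·e^{−τD}` (`B15HDecayLeaves.loc_le_of_meanValue`).  For (1.23):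
`m < 11d²ε_h` (*«by the usual reasoning»* — on the lattice the [IV] (1.90) mechanism, `B15LayerLocal.layer190_lt_local`), `D` = the
distance from the blocks of `Ω″_j ∩ Ω^c_k` to the layer at `∂Ω″~²_{h+1}` with `δMR_{h+1} ≤ τD` (print's `exp(−δMR_{h+1})`), the
bracket `[(L^jη)^{−1}, (L^jη)^{−2}]` of (190) as the weights of the two output entries (`L^jη·C₀κc ≤ B₃`, `(L^jη)²·C₁κc ≤ B₃`), and
the chain `ε_h ≤ (1+β₀)²N^{β₀}ε_k`, `N ≤ R_k` (r13's `B16Sect1Statements.fieldBound123_chain`).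

WHAT THIS FILE PROVES (kernel-checked, zero `sorry`, theorems only — no definition, no named fact; axioms standard; BY NAME:
`B15HDecayLeaves.loc_le_of_meanValue` (r12), `B16Sect1Statements.Ineq123`/`rhs123`/`fieldBound123_chain` (r13),
`B15LayerLocal.layer190_lt_local` (p29 g7), `B11SupSize190.supSize`/`norm_apply_apply_le_loc` and
`B11SeminormSize190.covDerivBlockSize`/`norm_covDerivFwd_le_loc` (r11)).
§1 `supNorm_lt`, `loc_lt_of_forall` — STRICT forms of r11's `supNorm_le`/`loc_le_of_forall`; **`loc_layer190_lt`** — the STRICT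
   B-size `< 11d²ε_h` of the [IV] (1.90)-type layer field at the sup size (p29 g7's `loc_layer190_le` was stated with `≤`).
§2 **`ineq123_of_ineq190`** — **(1.23) AS TYPED** (`Ineq123 Ljη nH nGradH B₃ δ M Rh1 d β₀ Rk εk`, both strict members) over r12's
   `BlockNorm` carriers: (190) at every base point for the value size (`C₀`) and the covariant-derivative size (`C₁`), (2.61), `σ + τ ≤
   ⅛δ₀`, the argument field of B-size `< 11d²ε_h` at every block and `= 0` on the blocks closer than `D`, `δMR_{h+1} ≤ τD`, `hmv` for
   both sizes, the weights, the chain inputs, and the dictionary letters `nH ≤ bout₀.loc y 𝐇`, `nGradH ≤ bout₁.loc y 𝐇`.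
§3 **`ineq123_lattice_of_ineq190_layer`** — THE SAME ON THE LATTICE WITH ALL SIZES CONCRETE: input size `supSize gB boxB blkB` on the
   index set `X` of the layer tower of a free fine field `W` (`B i = log[M^{K−dep i}(W)(b_i)((Q^{s*}_{dep i}M^K(W))(b_i))⁻¹]`, print's
   argument of `𝐇_{𝐁₁}`), its size `< 11d²ε_h` DISCHARGED by `loc_layer190_lt` from the located plaquette input on the finest cube,
   localisation ↦ `hfar`, `κ = 1`; output sizes `supSize gB box blk` (values) and `covDerivBlockSize gB y₀ S ξ U₀` (covariant derivatives
   at the background `U⁰(𝐁₁)`); the dictionary letters REPLACED by membership (`x ∈ box y`, `(x, μ′, ν) ∈ S y`): `Ineq123 Ljη ‖𝐇(x)_μ‖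
   ‖(∇^ξ_{U₀,μ′}𝐇_ν)(x)‖ …` — the B16 twin of r12's `B15From190LayerSizes.ineq191_twoSup_of_ineq190_layerW` input side.
§4 (v1.1) **END TO END FROM THE LOCATED LEAVES OF [15] SECT. G** — `weighted_loc_lt_rhs123` (the generic one-size step of §2 made
   public: ONE output size with its (190) constant and weight ⇒ `w·bout.loc y 𝐇 < rhs123`), `ineq123_of_ineq190₂` (§2 with the two
   output sizes on TWO carriers `FA₀`/`FA₁` and two derivative families), `const190_nonneg`, and **`ineq123_sectG`**: (1.23) AS TYPED for
   the values `‖ev₀ x (𝓗(B))‖` and `‖ev₁ i (𝓗(B))‖` of ANY two lattice presentations `ev₀ : X₀ → (𝒴 →L[ℝ] E₀)`, `ev₁ : X₁ → (𝒴 →L[ℝ] E₁)`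
   (compatibility letters `‖ev x v‖ ≤ bN.loc y v` on the box of `y`) of r08's (179)–(180) chart `𝓗 = B11Eq183Differentiation.chartH179 …`,
   with BOTH located premises of §2 — (190) at every base point (`h190₀`/`h190₁`) AND the mean-value domination (`hmv₀`/`hmv₁`) —
   DISCHARGED BY NAME by r08 g10's `B11Ineq190Actual.ineq190_and_hmv_supSize_sectG` (p304614; itself = r08's (190) for the actual
   Fréchet derivative `ineq190_sectG_dom` + p29 g9's `B11Presentation190.ineq190_and_hmv_supSize_chartH179`): the remaining hypotheses
   are r08's located leaves of [15] Sect. G ((189) `h189`, the kernel letters of `G̃`/`Δ⁽²⁾H₀`/`H₀`/`H`, (73) `hDfr`, (2.54) `htri`,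
   `q < 1`, the size↔norm letters `hN`/`hBloc`, the scheme's `Regime` and analyticity letters, the domain condition on `B`), ONE row
   sum (2.61) at a rate `σ` with `σ + τ ≤ ⅛δ₀` (fed to r08 at `⅛δ₀` by `RowSum.mono`), and the [16]-side letters of §2 (B-size of the
   argument `< 11d²ε_h` and `= 0` closer than `D`, `δMR_{h+1} ≤ τD`, the weights against (190)'s constant `const190 …`, the chain inputs).
READING NOTE (located, not a GAPS claim).  Print's *«by the usual reasoning»* is read as the [IV] p. 198 mechanism for (1.90) whose
located input in the tree is the plaquette bound `½ε_h(L^K)⁻²` on the finest cube (`layer190_lt_local`, output `11d²ε_h`); print invokes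
the regularity (1.96) [IV] (threshold `< ¾ε_h`, final member `< (1−β(…))ε_h`) «forgetting the field B′» — with a threshold `αε_h` the
same mechanism gives `22d²αε_h`, so the printed `11d²` corresponds to `α = ½` (the `χ_{h,1/2}` restriction of [IV] (1.88) in force on
the region); §3 takes the located input in the `½` form, §2 takes the printed number `11d²ε_h` as the bound of the field, as printed.
HONEST SCOPE.  In §2/§3: (190) itself (row B11.Eq190), (2.61), `hmv` (for the concrete chart: `B11MeanValue190Chart`/`B11Presentation190`);
in §4 (190) and `hmv` are DERIVED for the (179) chart and what remains is r08's list of located leaves of [15] Sect. G (see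
`B11Ineq190Actual`'s HONEST SCOPE: (189) is author-omitted, G-B11-G2; the transport words «Proposition 2 and (181)», G-B11-G2a, are not
typed); throughout, the identification of `𝐇_{𝐁₁}` with a (174)/(179) chart, the geometry (`hfar`, `δMR_{h+1} ≤ τD`) and the constants' bookkeeping
(`L^jη·C₀κc ≤ B₃` …) remain the located hypotheses, exactly as in r12's B15 knits; nothing about U⁰(𝐁₁)'s construction ((1.22), (1.25))
is used.  NOT summit progress.
-/

namespace Literature.MathematicalPhysics.QuantumFieldTheory.Balaban1983to89.B16Ineq123From190

open Literature.MathematicalPhysics.QuantumFieldTheory.Balaban1983to89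
open B11SectG B11SupSize190 B11SeminormSize190 B15HDecayLeaves B16Sect1Statements B16Sect1Kernels
open scoped NNReal

/-! ## §1. Strict sup sizes -/

section Strict

variable {X : Type*} {E : Type*} [SeminormedAddCommGroup E]

/-- STRICT form of `B11SupSize190.supNorm_le`: `(∀ x ∈ s, ‖f x‖ < c) → 0 < c → supNorm s f < c` (a finite max of numbers `< c`).
[cite: Balaban1985Variational, (190) p.308] -/
theorem supNorm_lt {s : Finset X} {f : X → E} {c : ℝ} (hc : 0 < c) (h : ∀ x ∈ s, ‖f x‖ < c) : supNorm s f < c := by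
  have h1 : (s.sup fun x => ‖f x‖₊) < c.toNNReal :=
    (Finset.sup_lt_iff (show (⊥ : ℝ≥0) < c.toNNReal from Real.toNNReal_pos.mpr hc)).mpr fun x hx => by
      rw [← NNReal.coe_lt_coe, coe_nnnorm, Real.coe_toNNReal _ hc.le]
      exact h x hx
  have h2 : ((s.sup fun x => ‖f x‖₊ : ℝ≥0) : ℝ) < ((c.toNNReal : ℝ≥0) : ℝ) := NNReal.coe_lt_coe.mpr h1
  rw [Real.coe_toNNReal _ hc.le] at h2
  exact h2

end Strict

section StrictSize

variable {g : B6.Geometry} {X : Type} {E : Type} [NormedAddCommGroup E] [Module ℝ E]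
variable {box : g.Site → Finset X} {blk : X → g.Site}

/-- STRICT form of `B11SupSize190.loc_le_of_forall`: `(∀ x ∈ box y, ‖f x‖ < c) → 0 < c → (supSize g box blk).loc y f < c`.
[cite: Balaban1985Variational, (190) p.308] -/
theorem loc_lt_of_forall {y : g.Site} {f : X → E} {c : ℝ} (hc : 0 < c) (h : ∀ x ∈ box y, ‖f x‖ < c) :
    (supSize g box blk : BlockNorm g (X → E)).loc y f < c :=
  supNorm_lt hc h

/-- A nonzero sup size exhibits a nonzero value in the box (r12's private helper, re-proved). [cite: Balaban1985Variational, (190) p.308] -/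
private theorem exists_ne_zero_of_loc_ne_zero {y : g.Site} {f : X → E}
    (h : (supSize g box blk : BlockNorm g (X → E)).loc y f ≠ 0) : ∃ x ∈ box y, f x ≠ 0 := by
  by_contra hc
  refine h (le_antisymm (loc_le_of_forall le_rfl fun x hx => ?_) ((supSize g box blk : BlockNorm g (X → E)).loc_nonneg y f))
  rw [Classical.not_not.1 (fun hx' => hc ⟨x, hx, hx'⟩), norm_zero]

end StrictSize

section Layer

open MatrixLog B7Prop1Explicit B7Prop2Explicit B7Prop1Local B8Lemma1NonAbelian B8Ineq129 B8Ineq130 B8Ineq165Descent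
  B15Ineq184BlockAxial B15Ineq184Local B8Eq115GaugeFixing B15Layer130Lattice B14ArgField36Lattice B15Layer199Lattice
  B15LayerLocal B15LayerSupSize

variable {d : ℕ} {gB : B6.Geometry} {X : Type}
variable {𝔸 : Type} [NormedRing 𝔸] [NormOneClass 𝔸] [NormedAlgebra ℂ 𝔸] [CompleteSpace 𝔸]

/-- **The layer field's B-size is STRICTLY below `11d²ε_h` at the sup size** (print: *«By the usual reasoning the field in the argument
of the function 𝐇_{𝐁₁} can be bounded by 11d²ε_h»*; the [IV] (1.90) mechanism of `B15LayerLocal.layer190_lt_local` — plaquette bound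
`½ε_h(L^K)⁻²` on the finest cube of a `K`-level tower of the fine field `W`, block-axial gauge on the tower, value group closed under
averaging — bondwise strict, hence strict for the finite max over any box). [cite: Balaban1989LargeFieldII, p.362 (before (1.23)); Balaban1989LargeFieldI, p.198] -/
theorem loc_layer190_lt (boxB : gB.Site → Finset X) (blkB : X → gB.Site) (dep : X → ℕ)
    (pt : X → B7Prop1Explicit.Site d) (dir : X → Fin d)
    (L : ℕ) (hL : 2 ≤ L) (hd : 1 ≤ d) {G : Subgroup 𝔸ˣ} (hG : AvgClosed d L G)
    (K : ℕ) (W : B7Prop1Explicit.Site d → Fin d → 𝔸ˣ) (hW : ∀ x κ, W x κ ∈ G) {εh : ℝ} (hε : 0 < εh)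
    (hs3 : C0 d * (εh * (1 / 2)) ≤ 1 / 3) (hs2 : 2 * (εh * (1 / 2)) ≤ c2' d L)
    (hs : 11 * (d : ℝ) ^ 2 * (εh * (1 / 2)) ≤ 1 / 6) (lo hi : B7Prop1Explicit.Site d) (hlohi : lo ≤ hi)
    (h : pdevOn (tlo L lo K) (thi L hi K) W < εh * (1 / 2) * (((L : ℝ) ^ K)⁻¹) ^ 2)
    (h15 : ∀ n, n < K → ∀ z, tlo L lo n ≤ z → z ≤ thi L hi n → ∀ r : Fin d → Fin L,
      axialFn (avgIter L W (K - (n + 1))) ((L : ℤ) • z) ((L : ℤ) • z + boxVec L r) = 1)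
    (hX : ∀ i, dep i ≤ K ∧ tlo L lo (dep i) ≤ pt i ∧ pt i + e (dir i) ≤ thi L hi (dep i)) (y : gB.Site) :
    (supSize gB boxB blkB : BlockNorm gB (X → 𝔸)).loc y
        (fun i => mlog (((avgIter L W (K - dep i) (pt i) (dir i) *
          (pullIter L (avgIter L W K) (dep i) (pt i) (dir i))⁻¹ : 𝔸ˣ) : 𝔸))) < 11 * (d : ℝ) ^ 2 * εh := by
  have hd0 : (0 : ℝ) < d := by exact_mod_cast hd
  exact loc_lt_of_forall (by positivity) fun i _ =>
    layer190_lt_local L hL hd hG K W hW hε hs3 hs2 hs lo hi hlohi h h15 (dep i) (hX i).1 (pt i) (dir i)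
      (hX i).2.1 (hX i).2.2

end Layer

/-! ## §2. (1.23) AS TYPED from the (190) record (abstract `BlockNorm` carriers) -/

section Abstract

variable {g : B6.Geometry} {FB FA : Type} [AddCommGroup FB] [Module ℝ FB] [AddCommGroup FA] [Module ℝ FA]

/-- **(1.23) p. 362 FROM [15] (190)** — r13's typed leaf `B16Sect1Statements.Ineq123 Ljη nH nGradH B₃ δ M Rh1 d β₀ Rk εk` (both
strict members `L^jη·nH < rhs123`, `(L^jη)²·nGradH < rhs123`) DERIVED: with (190) at every base point `t` for the VALUE size `bout₀`
(constant `C₀`) and for the COVARIANT-DERIVATIVE size `bout₁` (`C₁`) of `𝐇 = 𝐇_{𝐁₁}(B)`, (2.61) at rate `σ`, `τ ≥ 0`, `σ + τ ≤ ⅛δ₀`,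
the argument field `B` of B-size `< 11d²ε_h` at every block (*«by the usual reasoning … bounded by 11d²ε_h»*) and `= 0` on the blocks
`y′` with `d(y,y′) < D` (*«support in the boundary layer … at the boundary ∂Ω″~²_{h+1}»*), `δMR_{h+1} ≤ τD` (the point of `Ω″_j ∩ Ω^c_k`
seen from the layer), the mean-value domination for both sizes, the weights of (190)'s bracket `L^jη·C₀κ_Bc ≤ B₃`,
`(L^jη)²·C₁κ_Bc ≤ B₃`, the chain inputs `ε_h ≤ (1+β₀)²N^{β₀}ε_k` ((2.8) [III]-type) and `N ≤ R_k` (p. 361), and the dictionary letters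
(the point `x` lies in the block `y`). [cite: Balaban1989LargeFieldII, (1.23) p.362; Balaban1985Variational, (190) p.308] -/
theorem ineq123_of_ineq190 {T : Type*} {bB : BlockNorm g FB} {bout₀ bout₁ : BlockNorm g FA}
    {dH : T → FB →ₗ[ℝ] FA} {C₀ C₁ δ₀ σ τ c D B₃ δ M Rh1 Ljη εh εk β₀ Rk nH nGradH : ℝ} {N d : ℕ}
    (h190₀ : ∀ t, Ineq190 bB bout₀ (dH t) C₀ δ₀) (h190₁ : ∀ t, Ineq190 bB bout₁ (dH t) C₁ δ₀)
    (hC₀ : 0 ≤ C₀) (hC₁ : 0 ≤ C₁) (hd : ∀ a b : g.Site, 0 ≤ g.dist a b) (hrow : RowSum g σ c) (hτ : 0 ≤ τ)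
    (hστ : σ + τ ≤ δ₀ / 8) (B : FB) (y : g.Site)
    (hm : ∀ y', bB.loc y' B < 11 * (d : ℝ) ^ 2 * εh) (hD : ∀ y', bB.loc y' B ≠ 0 → D ≤ g.dist y y') {HB : FA}
    (hmv₀ : ∀ s : ℝ, (∀ t, bout₀.loc y (dH t B) ≤ s) → bout₀.loc y HB ≤ s)
    (hmv₁ : ∀ s : ℝ, (∀ t, bout₁.loc y (dH t B) ≤ s) → bout₁.loc y HB ≤ s)
    (hgeom : δ * M * Rh1 ≤ τ * D) (hCB₀ : Ljη * (C₀ * bB.κ * c) ≤ B₃) (hCB₁ : Ljη ^ 2 * (C₁ * bB.κ * c) ≤ B₃)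
    (hB₃ : 0 < B₃) (hLjη : 0 ≤ Ljη) (hεk : 0 ≤ εk) (hβ : 0 ≤ β₀)
    (hεh : εh ≤ (1 + β₀) ^ 2 * (N : ℝ) ^ β₀ * εk) (hN : NWindowUpper N Rk)
    (hdom₀ : nH ≤ bout₀.loc y HB) (hdom₁ : nGradH ≤ bout₁.loc y HB) :
    Ineq123 Ljη nH nGradH B₃ δ M Rh1 d β₀ Rk εk := by
  classical
  haveI := g.fin
  -- the uniform B-size `m := max_{y′} loc y′ B < 11d²ε_h`
  set m : ℝ := Finset.univ.sup' ⟨y, Finset.mem_univ y⟩ (fun y' => bB.loc y' B) with hm_def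
  have hm_le : ∀ y', bB.loc y' B ≤ m := fun y' => Finset.le_sup' (fun y' => bB.loc y' B) (Finset.mem_univ y')
  have hm_lt : m < 11 * (d : ℝ) ^ 2 * εh := (Finset.sup'_lt_iff _).mpr fun y' _ => hm y'
  have hm0 : 0 ≤ m := (bB.loc_nonneg y B).trans (hm_le y)
  have hexp : Real.exp (-(τ * D)) ≤ Real.exp (-(δ * M * Rh1)) := Real.exp_le_exp.mpr (by linarith)
  have hE : 0 < Real.exp (-(δ * M * Rh1)) := Real.exp_pos _
  obtain ⟨hch1, hch2⟩ := fieldBound123_chain (d := d) hεk hβ hεh hN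
  have hchain : 11 * (d : ℝ) ^ 2 * εh ≤ 11 * (d : ℝ) ^ 2 * (1 + β₀) ^ 2 * Rk ^ β₀ * εk := hch1.trans hch2
  -- the generic step: one output size with its (190) constant `Cc` and weight `w`
  have key : ∀ {bout : BlockNorm g FA} {Cc w : ℝ}, (∀ t, Ineq190 bB bout (dH t) Cc δ₀) → 0 ≤ Cc →
      (∀ s : ℝ, (∀ t, bout.loc y (dH t B) ≤ s) → bout.loc y HB ≤ s) → 0 ≤ w → w * (Cc * bB.κ * c) ≤ B₃ →
      w * bout.loc y HB < rhs123 B₃ δ M Rh1 d β₀ Rk εk := by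
    intro bout Cc w h190 hCc hmv hw hCB
    have h := loc_le_of_meanValue h190 hCc hd hrow hτ hστ B hm_le y hD hmv
    have h1 : w * bout.loc y HB ≤ (w * (Cc * bB.κ * c)) * (m * Real.exp (-(τ * D))) := by
      have := mul_le_mul_of_nonneg_left h hw
      calc w * bout.loc y HB ≤ w * (Cc * bB.κ * c * m * Real.exp (-(τ * D))) := this
        _ = (w * (Cc * bB.κ * c)) * (m * Real.exp (-(τ * D))) := by ring
    have h2 : (w * (Cc * bB.κ * c)) * (m * Real.exp (-(τ * D))) ≤ B₃ * (m * Real.exp (-(δ * M * Rh1))) :=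
      mul_le_mul hCB (mul_le_mul_of_nonneg_left hexp hm0) (by positivity) hB₃.le
    have h3 : B₃ * (m * Real.exp (-(δ * M * Rh1))) < B₃ * (11 * (d : ℝ) ^ 2 * εh * Real.exp (-(δ * M * Rh1))) :=
      mul_lt_mul_of_pos_left (mul_lt_mul_of_pos_right hm_lt hE) hB₃
    have h4 : B₃ * (11 * (d : ℝ) ^ 2 * εh * Real.exp (-(δ * M * Rh1))) ≤
        B₃ * (11 * (d : ℝ) ^ 2 * (1 + β₀) ^ 2 * Rk ^ β₀ * εk * Real.exp (-(δ * M * Rh1))) :=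
      mul_le_mul_of_nonneg_left (mul_le_mul_of_nonneg_right hchain hE.le) hB₃.le
    have h5 : B₃ * (11 * (d : ℝ) ^ 2 * (1 + β₀) ^ 2 * Rk ^ β₀ * εk * Real.exp (-(δ * M * Rh1))) =
        rhs123 B₃ δ M Rh1 d β₀ Rk εk := by
      unfold rhs123; ring
    linarith [h1, h2, h3, h4, h5]
  refine ⟨?_, ?_⟩
  · exact (mul_le_mul_of_nonneg_left hdom₀ hLjη).trans_lt (key h190₀ hC₀ hmv₀ hLjη hCB₀)
  · exact (mul_le_mul_of_nonneg_left hdom₁ (sq_nonneg Ljη)).trans_lt (key h190₁ hC₁ hmv₁ (sq_nonneg Ljη) hCB₁)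

end Abstract

/-! ## §3. (1.23) ON THE LATTICE with all sizes concrete -/

section Lattice

open MatrixLog B7Prop1Explicit B7Prop2Explicit B7Prop1Local B8Lemma1NonAbelian B8Ineq129 B8Ineq130 B8Ineq165Descent
  B15Ineq184BlockAxial B15Ineq184Local B8Eq115GaugeFixing B15Layer130Lattice B14ArgField36Lattice B15Layer199Lattice
  B15LayerLocal B15LayerSupSize

variable {d : ℕ} {gB : B6.Geometry} {X : Type}
variable {𝔸 : Type} [NormedRing 𝔸] [NormOneClass 𝔸] [NormedAlgebra ℂ 𝔸] [CompleteSpace 𝔸]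

/-- **(1.23) p. 362 ON THE LATTICE, FROM [15] (190), ALL SIZES CONCRETE.**  INPUT size `bB := supSize gB boxB blkB` on the index set `X`
of the layer tower (`K` levels, fine field `W`, `B i = log[M^{K−dep i}(W)(b_i)((Q^{s*}_{dep i}M^K(W))(b_i))⁻¹]` — the argument of
`𝐇_{𝐁₁}`, supported in the boundary layer at `∂Ω″~²_{h+1}`), its size `< 11d²ε_h` DISCHARGED by `loc_layer190_lt` from the located
plaquette input `½ε_h(L^K)⁻²` on the finest cube, the localisation as box geometry `hfar : i ∈ boxB y′ → D ≤ d(y,y′)`, `κ_B = 1`;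
OUTPUT sizes `bout₀ := supSize gB box blk` (values of `𝐇 : Site d → Fin d → 𝔸`) and `bout₁ := covDerivBlockSize gB y₀ S ξ U₀` (covariant
derivatives (1.1) [6] at the background `U₀ = U⁰(𝐁₁)`), the dictionary letters REPLACED by membership `x ∈ box y`, `(x, μ′, ν) ∈ S y`:
the typed leaf `Ineq123 Ljη ‖𝐇(x)_μ‖ ‖(∇^ξ_{U₀,μ′}𝐇_ν)(x)‖ B₃ δ M Rh1 d β₀ Rk εk`.
[cite: Balaban1989LargeFieldII, (1.23) p.362; Balaban1985Variational, (190) p.308; Balaban1989LargeFieldI, p.198] -/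
theorem ineq123_lattice_of_ineq190_layer
    (boxB : gB.Site → Finset X) (blkB : X → gB.Site) (dep : X → ℕ) (pt : X → B7Prop1Explicit.Site d) (dir : X → Fin d)
    (box : gB.Site → Finset (B7Prop1Explicit.Site d)) (blk : B7Prop1Explicit.Site d → gB.Site)
    (y₀ : gB.Site) (S : gB.Site → Finset (B7Prop1Explicit.Site d × Fin d × Fin d))
    {T : Type*} {dH : T → (X → 𝔸) →ₗ[ℝ] (B7Prop1Explicit.Site d → Fin d → 𝔸)}
    {C₀ C₁ δ₀ σ τ c D B₃ δ M Rh1 Ljη εh εk β₀ Rk : ℝ} {N : ℕ}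
    {ξ : ℝ} {L : ℕ} {K : ℕ} {U₀ : B7Prop1Explicit.Site d → Fin d → 𝔸ˣ}
    (h190₀ : ∀ t, Ineq190 (supSize (X := X) (E := 𝔸) gB boxB blkB)
      (supSize (X := B7Prop1Explicit.Site d) (E := Fin d → 𝔸) gB box blk) (dH t) C₀ δ₀)
    (h190₁ : ∀ t, Ineq190 (supSize (X := X) (E := 𝔸) gB boxB blkB) (covDerivBlockSize gB y₀ S ξ U₀) (dH t) C₁ δ₀)
    (hC₀ : 0 ≤ C₀) (hC₁ : 0 ≤ C₁) (hdist : ∀ a b : gB.Site, 0 ≤ gB.dist a b) (hrow : RowSum gB σ c) (hτ : 0 ≤ τ)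
    (hστ : σ + τ ≤ δ₀ / 8) (y : gB.Site)
    -- the layer tower of the argument field (as in `loc_layer190_lt`)
    (hL : 2 ≤ L) (hd1 : 1 ≤ d) {G : Subgroup 𝔸ˣ} (hG : AvgClosed d L G)
    (W : B7Prop1Explicit.Site d → Fin d → 𝔸ˣ) (hW : ∀ x κ, W x κ ∈ G) (hε : 0 < εh)
    (hs3 : C0 d * (εh * (1 / 2)) ≤ 1 / 3) (hs2 : 2 * (εh * (1 / 2)) ≤ c2' d L)
    (hs : 11 * (d : ℝ) ^ 2 * (εh * (1 / 2)) ≤ 1 / 6) (lo hi : B7Prop1Explicit.Site d) (hlohi : lo ≤ hi)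
    (h190p : pdevOn (tlo L lo K) (thi L hi K) W < εh * (1 / 2) * (((L : ℝ) ^ K)⁻¹) ^ 2)
    (h15 : ∀ n, n < K → ∀ z, tlo L lo n ≤ z → z ≤ thi L hi n → ∀ r : Fin d → Fin L,
      axialFn (avgIter L W (K - (n + 1))) ((L : ℤ) • z) ((L : ℤ) • z + boxVec L r) = 1)
    (hX : ∀ i, dep i ≤ K ∧ tlo L lo (dep i) ≤ pt i ∧ pt i + e (dir i) ≤ thi L hi (dep i))
    (hfar : ∀ y' i, i ∈ boxB y' → D ≤ gB.dist y y')
    -- the consumer: `𝐇 = 𝐇_{𝐁₁}(B)` and the mean-value domination for the two output sizes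
    {H : B7Prop1Explicit.Site d → Fin d → 𝔸}
    (hmv₀ : ∀ s : ℝ, (∀ t, (supSize (X := B7Prop1Explicit.Site d) (E := Fin d → 𝔸) gB box blk).loc y (dH t
        (fun i => mlog (((avgIter L W (K - dep i) (pt i) (dir i) *
          (pullIter L (avgIter L W K) (dep i) (pt i) (dir i))⁻¹ : 𝔸ˣ) : 𝔸)))) ≤ s) →
      (supSize (X := B7Prop1Explicit.Site d) (E := Fin d → 𝔸) gB box blk).loc y H ≤ s)
    (hmv₁ : ∀ s : ℝ, (∀ t, (covDerivBlockSize gB y₀ S ξ U₀).loc y (dH t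
        (fun i => mlog (((avgIter L W (K - dep i) (pt i) (dir i) *
          (pullIter L (avgIter L W K) (dep i) (pt i) (dir i))⁻¹ : 𝔸ˣ) : 𝔸)))) ≤ s) →
      (covDerivBlockSize gB y₀ S ξ U₀).loc y H ≤ s)
    (hgeom : δ * M * Rh1 ≤ τ * D) (hCB₀ : Ljη * (C₀ * c) ≤ B₃) (hCB₁ : Ljη ^ 2 * (C₁ * c) ≤ B₃) (hB₃ : 0 < B₃)
    (hLjη : 0 ≤ Ljη) (hεk : 0 ≤ εk) (hβ : 0 ≤ β₀) (hεh : εh ≤ (1 + β₀) ^ 2 * (N : ℝ) ^ β₀ * εk)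
    (hN : NWindowUpper N Rk)
    -- the output dictionaries as set geometry
    {x : B7Prop1Explicit.Site d} {μ μ' ν : Fin d} (hx : x ∈ box y) (hS : (x, μ', ν) ∈ S y) :
    Ineq123 Ljη ‖H x μ‖ ‖B8Ineq132.covDerivFwd ξ U₀ μ' (fun z => H z ν) x‖ B₃ δ M Rh1 d β₀ Rk εk :=
  ineq123_of_ineq190 h190₀ h190₁ hC₀ hC₁ hdist hrow hτ hστ _ y
    (loc_layer190_lt boxB blkB dep pt dir L hL hd1 hG K W hW hε hs3 hs2 hs lo hi hlohi h190p h15 hX)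
    (fun y' hne => by obtain ⟨i, hi, -⟩ := exists_ne_zero_of_loc_ne_zero hne; exact hfar y' i hi)
    hmv₀ hmv₁ hgeom (by rw [supSize_κ, mul_one]; exact hCB₀) (by rw [supSize_κ, mul_one]; exact hCB₁) hB₃ hLjη hεk hβ hεh hN
    (norm_apply_apply_le_loc hx H μ) (norm_covDerivFwd_le_loc hS H)

end Lattice

/-! ## §4. (1.23) END TO END from the located leaves of [15] Sect. G (v1.1) -/

section OneSize

variable {g : B6.Geometry} {FB : Type} [AddCommGroup FB] [Module ℝ FB]

/-- **The generic one-size step of §2, public**: ONE output size `bout` of `𝐇 = 𝐇_{𝐁₁}(B)` with (190) at every base point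
(constant `Cc`), (2.61) at rate `σ`, `τ ≥ 0`, `σ + τ ≤ ⅛δ₀`, the argument field of B-size `< 11d²ε_h` everywhere and `= 0` closer than
`D` to `y`, `δMR_{h+1} ≤ τD`, the mean-value domination, a weight `w ≥ 0` with `w·Cc·κ_B·c ≤ B₃`, and the chain inputs
`ε_h ≤ (1+β₀)²N^{β₀}ε_k`, `N ≤ R_k` ⇒ `w · bout.loc y 𝐇 < rhs123 = B₃e^{−δMR_{h+1}}·11d²(1+β₀)²R_k^{β₀}ε_k` (STRICT, from the strict
B-size). [cite: Balaban1989LargeFieldII, (1.23) p.362; Balaban1985Variational, (190) p.308] -/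
theorem weighted_loc_lt_rhs123 {T : Type*} {FA : Type} [AddCommGroup FA] [Module ℝ FA] {bB : BlockNorm g FB} {bout : BlockNorm g FA}
    {dH : T → FB →ₗ[ℝ] FA} {Cc δ₀ σ τ c D B₃ δ M Rh1 w εh εk β₀ Rk : ℝ} {N d : ℕ}
    (h190 : ∀ t, Ineq190 bB bout (dH t) Cc δ₀) (hCc : 0 ≤ Cc) (hd : ∀ a b : g.Site, 0 ≤ g.dist a b) (hrow : RowSum g σ c)
    (hτ : 0 ≤ τ) (hστ : σ + τ ≤ δ₀ / 8) (B : FB) (y : g.Site)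
    (hm : ∀ y', bB.loc y' B < 11 * (d : ℝ) ^ 2 * εh) (hD : ∀ y', bB.loc y' B ≠ 0 → D ≤ g.dist y y') {HB : FA}
    (hmv : ∀ s : ℝ, (∀ t, bout.loc y (dH t B) ≤ s) → bout.loc y HB ≤ s)
    (hgeom : δ * M * Rh1 ≤ τ * D) (hw : 0 ≤ w) (hCB : w * (Cc * bB.κ * c) ≤ B₃) (hB₃ : 0 < B₃) (hεk : 0 ≤ εk) (hβ : 0 ≤ β₀)
    (hεh : εh ≤ (1 + β₀) ^ 2 * (N : ℝ) ^ β₀ * εk) (hN : NWindowUpper N Rk) :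
    w * bout.loc y HB < rhs123 B₃ δ M Rh1 d β₀ Rk εk := by
  classical
  haveI := g.fin
  -- the uniform B-size `m := max_{y′} loc y′ B < 11d²ε_h`
  set m : ℝ := Finset.univ.sup' ⟨y, Finset.mem_univ y⟩ (fun y' => bB.loc y' B) with hm_def
  have hm_le : ∀ y', bB.loc y' B ≤ m := fun y' => Finset.le_sup' (fun y' => bB.loc y' B) (Finset.mem_univ y')
  have hm_lt : m < 11 * (d : ℝ) ^ 2 * εh := (Finset.sup'_lt_iff _).mpr fun y' _ => hm y'
  have hm0 : 0 ≤ m := (bB.loc_nonneg y B).trans (hm_le y)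
  have hexp : Real.exp (-(τ * D)) ≤ Real.exp (-(δ * M * Rh1)) := Real.exp_le_exp.mpr (by linarith)
  have hE : 0 < Real.exp (-(δ * M * Rh1)) := Real.exp_pos _
  obtain ⟨hch1, hch2⟩ := fieldBound123_chain (d := d) hεk hβ hεh hN
  have hchain : 11 * (d : ℝ) ^ 2 * εh ≤ 11 * (d : ℝ) ^ 2 * (1 + β₀) ^ 2 * Rk ^ β₀ * εk := hch1.trans hch2
  have h := loc_le_of_meanValue h190 hCc hd hrow hτ hστ B hm_le y hD hmv
  have h1 : w * bout.loc y HB ≤ (w * (Cc * bB.κ * c)) * (m * Real.exp (-(τ * D))) := by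
    calc w * bout.loc y HB ≤ w * (Cc * bB.κ * c * m * Real.exp (-(τ * D))) := mul_le_mul_of_nonneg_left h hw
      _ = (w * (Cc * bB.κ * c)) * (m * Real.exp (-(τ * D))) := by ring
  have h2 : (w * (Cc * bB.κ * c)) * (m * Real.exp (-(τ * D))) ≤ B₃ * (m * Real.exp (-(δ * M * Rh1))) :=
    mul_le_mul hCB (mul_le_mul_of_nonneg_left hexp hm0) (by positivity) hB₃.le
  have h3 : B₃ * (m * Real.exp (-(δ * M * Rh1))) < B₃ * (11 * (d : ℝ) ^ 2 * εh * Real.exp (-(δ * M * Rh1))) :=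
    mul_lt_mul_of_pos_left (mul_lt_mul_of_pos_right hm_lt hE) hB₃
  have h4 : B₃ * (11 * (d : ℝ) ^ 2 * εh * Real.exp (-(δ * M * Rh1))) ≤
      B₃ * (11 * (d : ℝ) ^ 2 * (1 + β₀) ^ 2 * Rk ^ β₀ * εk * Real.exp (-(δ * M * Rh1))) :=
    mul_le_mul_of_nonneg_left (mul_le_mul_of_nonneg_right hchain hE.le) hB₃.le
  have h5 : B₃ * (11 * (d : ℝ) ^ 2 * (1 + β₀) ^ 2 * Rk ^ β₀ * εk * Real.exp (-(δ * M * Rh1))) =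
      rhs123 B₃ δ M Rh1 d β₀ Rk εk := by
    unfold rhs123; ring
  linarith [h1, h2, h3, h4, h5]

/-- **(1.23) AS TYPED, the two output sizes on TWO carriers** (`FA₀` for the values of `𝐇`, `FA₁` for its covariant derivatives, each
with its own derivative family `dH₀`/`dH₁` and (190) constant `C₀`/`C₁` — the shape produced by two lattice presentations of one chart):
§2's `ineq123_of_ineq190` verbatim otherwise. [cite: Balaban1989LargeFieldII, (1.23) p.362; Balaban1985Variational, (190) p.308] -/
theorem ineq123_of_ineq190₂ {T₀ T₁ : Type*} {FA₀ FA₁ : Type} [AddCommGroup FA₀] [Module ℝ FA₀] [AddCommGroup FA₁] [Module ℝ FA₁]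
    {bB : BlockNorm g FB} {bout₀ : BlockNorm g FA₀} {bout₁ : BlockNorm g FA₁}
    {dH₀ : T₀ → FB →ₗ[ℝ] FA₀} {dH₁ : T₁ → FB →ₗ[ℝ] FA₁}
    {C₀ C₁ δ₀ σ τ c D B₃ δ M Rh1 Ljη εh εk β₀ Rk nH nGradH : ℝ} {N d : ℕ}
    (h190₀ : ∀ t, Ineq190 bB bout₀ (dH₀ t) C₀ δ₀) (h190₁ : ∀ t, Ineq190 bB bout₁ (dH₁ t) C₁ δ₀)
    (hC₀ : 0 ≤ C₀) (hC₁ : 0 ≤ C₁) (hd : ∀ a b : g.Site, 0 ≤ g.dist a b) (hrow : RowSum g σ c) (hτ : 0 ≤ τ)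
    (hστ : σ + τ ≤ δ₀ / 8) (B : FB) (y : g.Site)
    (hm : ∀ y', bB.loc y' B < 11 * (d : ℝ) ^ 2 * εh) (hD : ∀ y', bB.loc y' B ≠ 0 → D ≤ g.dist y y') {HB₀ : FA₀} {HB₁ : FA₁}
    (hmv₀ : ∀ s : ℝ, (∀ t, bout₀.loc y (dH₀ t B) ≤ s) → bout₀.loc y HB₀ ≤ s)
    (hmv₁ : ∀ s : ℝ, (∀ t, bout₁.loc y (dH₁ t B) ≤ s) → bout₁.loc y HB₁ ≤ s)
    (hgeom : δ * M * Rh1 ≤ τ * D) (hCB₀ : Ljη * (C₀ * bB.κ * c) ≤ B₃) (hCB₁ : Ljη ^ 2 * (C₁ * bB.κ * c) ≤ B₃)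
    (hB₃ : 0 < B₃) (hLjη : 0 ≤ Ljη) (hεk : 0 ≤ εk) (hβ : 0 ≤ β₀)
    (hεh : εh ≤ (1 + β₀) ^ 2 * (N : ℝ) ^ β₀ * εk) (hN : NWindowUpper N Rk)
    (hdom₀ : nH ≤ bout₀.loc y HB₀) (hdom₁ : nGradH ≤ bout₁.loc y HB₁) :
    Ineq123 Ljη nH nGradH B₃ δ M Rh1 d β₀ Rk εk :=
  ⟨(mul_le_mul_of_nonneg_left hdom₀ hLjη).trans_lt
      (weighted_loc_lt_rhs123 h190₀ hC₀ hd hrow hτ hστ B y hm hD hmv₀ hgeom hLjη hCB₀ hB₃ hεk hβ hεh hN),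
    (mul_le_mul_of_nonneg_left hdom₁ (sq_nonneg Ljη)).trans_lt
      (weighted_loc_lt_rhs123 h190₁ hC₁ hd hrow hτ hστ B y hm hD hmv₁ hgeom (sq_nonneg Ljη) hCB₁ hB₃ hεk hβ hεh hN)⟩

end OneSize

/-- The (190) constant `const190 κ_B κ_N κ₃ B_G θ_W c_Δ A₀ A_H θ_𝔇 c` of `B11SectG` is `≥ 0` for non-negative data under the
smallness `q < 1` of (187). [cite: Balaban1985Variational, (187)–(190) p.308] -/
theorem const190_nonneg {κB κN κ₃ BG θW cΔ A₀ AH θD c : ℝ} (hκB : 0 ≤ κB) (hκN : 0 ≤ κN) (hκ₃ : 0 ≤ κ₃)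
    (hc : 0 ≤ c) (hBG : 0 ≤ BG) (hθW : 0 ≤ θW) (hcΔ : 0 ≤ cΔ) (hA₀ : 0 ≤ A₀) (hAH : 0 ≤ AH) (hθD : 0 ≤ θD)
    (hq : qG κ₃ κN BG θW c < 1) : 0 ≤ const190 κB κN κ₃ BG θW cΔ A₀ AH θD c := by
  unfold const190
  have h₁ := constA0_nonneg (cΔ := cΔ) hκ₃ hκN hBG hθW hcΔ hA₀ hc hq
  positivity

section SectG

open B11Eq174Chart B11Eq183Differentiation B11Presentation190 B11Ineq190Actual B6RandomWalk Set Metric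

variable {𝒳 𝒴 𝒵 : Type} [NormedAddCommGroup 𝒳] [NormedSpace ℂ 𝒳] [NormedAddCommGroup 𝒴] [NormedSpace ℂ 𝒴]
  [NormedAddCommGroup 𝒵] [NormedSpace ℂ 𝒵] [CompleteSpace 𝒳] [CompleteSpace 𝒴] [CompleteSpace 𝒵]
  {𝒢 : 𝒵 →L[ℂ] 𝒴} {W : 𝒴 → 𝒵} {D2 : 𝒴 →L[ℂ] 𝒵} {H₀ : 𝒳 →L[ℂ] 𝒴} {B₀ θ C₄ a₃ j a ε₄ : ℝ}
  {g : B6.Geometry} {X₀ X₁ E₀ E₁ : Type} [NormedAddCommGroup E₀] [NormedSpace ℝ E₀] [NormedAddCommGroup E₁] [NormedSpace ℝ E₁]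
  {box₀ : g.Site → Finset X₀} {box₁ : g.Site → Finset X₁}

/-- **(1.23) p. 362 END TO END FROM THE LOCATED LEAVES OF [15] SECT. G.**  For r08's (179)–(180) chart
`𝓗(B) = B11Eq183Differentiation.chartH179 𝒢 W D2 H₀ (· − H(D ·)) ε₄ B` (scheme of `B11Eq183Differentiation` §5: `Regime` (117)–(121),
`W = (δ/δA′)V` analytic on `‖Y‖ < a₃`, `T⁻ = · − H(D ·)` analytic on `‖Y‖ < ε₄ + a` with `T⁻0 = 0`, `B` in the domain of (180)) and ANY
two lattice presentations `ev₀ : X₀ → (𝒴 →L[ℝ] E₀)` (values, boxes `box₀`) and `ev₁ : X₁ → (𝒴 →L[ℝ] E₁)` (covariant derivatives, boxes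
`box₁`) compatible with the local size `bN` of (190) (`‖ev x v‖ ≤ bN.loc y v` on the box of `y`), r13's typed leaf
`Ineq123 Ljη ‖ev₀ x (𝓗(B))‖ ‖ev₁ i (𝓗(B))‖ B₃ δ M Rh1 d β₀ Rk εk` holds at every `x ∈ box₀ y`, `i ∈ box₁ y` — with (190) at every base
point AND the mean-value domination of §2 DISCHARGED by r08 g10's `B11Ineq190Actual.ineq190_and_hmv_supSize_sectG` (applied to each
presentation).  Hypotheses: r08's located leaves of Sect. G verbatim ((189) `h189` on the domain, the kernel letters `hG`/`hD2H0`/`hH0`/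
`hH`, (73) `hDfr`, (2.54) `htri`, `q < 1`, `hN`/`hBloc`), ONE row sum (2.61) `RowSum g σ c` with `τ ≥ 0`, `σ + τ ≤ ⅛δ₀` (fed to r08 at
the rate `⅛δ₀` by `RowSum.mono`), and the [16]-side letters of §2: the argument `B` of B-size `< 11d²ε_h` at every block and `= 0` on the
blocks closer than `D` to `y`, `δMR_{h+1} ≤ τD`, the weights `L^jη·K·κ_B·c ≤ B₃`, `(L^jη)²·K·κ_B·c ≤ B₃` against (190)'s constant
`K = const190 κ_B κ_N κ₃ B_G θ_W c_Δ A₀ A_H θ_𝔇 c`, and the chain inputs `ε_h ≤ (1+β₀)²N^{β₀}ε_k`, `N ≤ R_k`.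
[cite: Balaban1989LargeFieldII, (1.23) p.362; Balaban1985Variational, Prop. 9 (190) pp.308–309, (179)–(180) p.306] -/
theorem ineq123_sectG (R : Regime 𝒢 0 W B₀ θ C₄ a₃ j a ε₄) (hWa : AnalyticOnNhd ℂ W {Y : 𝒴 | ‖Y‖ < a₃})
    {D : 𝒴 → 𝒳} (H : 𝒳 →L[ℂ] 𝒴) (hTm : AnalyticOnNhd ℂ (fun Y : 𝒴 => Y - H (D Y)) {Y : 𝒴 | ‖Y‖ < ε₄ + a})
    (hTm0 : (0 : 𝒴) - H (D 0) = 0)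
    {B : 𝒳} (hB : ‖H₀ B‖ < a ∧ ‖D2 (H₀ B)‖ < j)
    (ev₀ : X₀ → (𝒴 →L[ℝ] E₀)) (ev₁ : X₁ → (𝒴 →L[ℝ] E₁))
    {bB : BlockNorm g 𝒳} {bN : BlockNorm g 𝒴} {b3 : BlockNorm g 𝒵}
    (hev₀ : ∀ (y : g.Site) (v : 𝒴), ∀ x ∈ box₀ y, ‖ev₀ x v‖ ≤ bN.loc y v)
    (hev₁ : ∀ (y : g.Site) (v : 𝒴), ∀ i ∈ box₁ y, ‖ev₁ i v‖ ≤ bN.loc y v)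
    (hN : ∀ (y : g.Site) (v : 𝒴), bN.loc y v ≤ ‖v‖) (hBloc : ∀ (y' : g.Site) (μ : 𝒳), bB.IsLoc y' μ → ‖μ‖ ≤ bB.loc y' μ)
    {δ₀ BG θW cΔ A₀ AH θD c : ℝ}
    (htri : Triangle254 g) (hd : ∀ a b : g.Site, 0 ≤ g.dist a b) (hδ₀ : 0 ≤ δ₀)
    (hc : 0 ≤ c) (hBG : 0 ≤ BG) (hθW : 0 ≤ θW) (hcΔ : 0 ≤ cΔ) (hA₀ : 0 ≤ A₀) (hAH : 0 ≤ AH) (hθD : 0 ≤ θD)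
    (hG : HasMaj b3 bN (𝒢.restrictScalars ℝ : 𝒵 →ₗ[ℝ] 𝒴) (fun y y' => BG * Real.exp (-(δ₀ * g.dist y y'))))
    (hD2H0 : HasMaj bB b3 ((D2 ∘L H₀).restrictScalars ℝ : 𝒳 →ₗ[ℝ] 𝒵) (fun y y' => cΔ * Real.exp (-(δ₀ * g.dist y y'))))
    (hH0 : HasMaj bB bN (H₀.restrictScalars ℝ : 𝒳 →ₗ[ℝ] 𝒴) (fun y y' => A₀ * Real.exp (-(δ₀ * g.dist y y'))))
    (hH : HasMaj bB bN (H.restrictScalars ℝ : 𝒳 →ₗ[ℝ] 𝒴) (fun y y' => AH * Real.exp (-(δ₀ / 2 * g.dist y y'))))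
    (h189 : ∀ B' : 𝒳, ‖H₀ B'‖ < a → ‖D2 (H₀ B')‖ < j →
      Ineq189 bN b3 ((fderiv ℂ W (solA180 𝒢 W D2 H₀ ε₄ B' + H₀ B')).restrictScalars ℝ : 𝒴 →ₗ[ℝ] 𝒵) θW δ₀)
    (hDfr : ∀ B' : 𝒳, ‖H₀ B'‖ < a → ‖D2 (H₀ B')‖ < j →
      ∃ 𝔇 : 𝒴 →L[ℂ] 𝒳, HasFDerivAt D 𝔇 (solA180 𝒢 W D2 H₀ ε₄ B' + H₀ B') ∧
        HasMaj bN bB (𝔇.restrictScalars ℝ : 𝒴 →ₗ[ℝ] 𝒳) (fun y y' => θD * Real.exp (-(δ₀ / 2 * g.dist y y'))))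
    (hq : qG b3.κ bN.κ BG θW c < 1)
    -- the [16] side (§2's letters)
    {σ τ Dd B₃ δ M Rh1 Ljη εh εk β₀ Rk : ℝ} {N d : ℕ}
    (hrow : RowSum g σ c) (hτ : 0 ≤ τ) (hστ : σ + τ ≤ δ₀ / 8) (y : g.Site)
    (hm : ∀ y', bB.loc y' B < 11 * (d : ℝ) ^ 2 * εh) (hD : ∀ y', bB.loc y' B ≠ 0 → Dd ≤ g.dist y y')
    (hgeom : δ * M * Rh1 ≤ τ * Dd)
    (hCB₀ : Ljη * (const190 bB.κ bN.κ b3.κ BG θW cΔ A₀ AH θD c * bB.κ * c) ≤ B₃)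
    (hCB₁ : Ljη ^ 2 * (const190 bB.κ bN.κ b3.κ BG θW cΔ A₀ AH θD c * bB.κ * c) ≤ B₃)
    (hB₃ : 0 < B₃) (hLjη : 0 ≤ Ljη) (hεk : 0 ≤ εk) (hβ : 0 ≤ β₀)
    (hεh : εh ≤ (1 + β₀) ^ 2 * (N : ℝ) ^ β₀ * εk) (hNR : NWindowUpper N Rk)
    {x : X₀} {i : X₁} (hx : x ∈ box₀ y) (hi : i ∈ box₁ y) :
    Ineq123 Ljη ‖ev₀ x (chartH179 𝒢 W D2 H₀ (fun Y : 𝒴 => Y - H (D Y)) ε₄ B)‖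
      ‖ev₁ i (chartH179 𝒢 W D2 H₀ (fun Y : 𝒴 => Y - H (D Y)) ε₄ B)‖ B₃ δ M Rh1 d β₀ Rk εk := by
  have hrow8 : RowSum g (δ₀ / 8) c := hrow.mono hd (by linarith)
  have hK : 0 ≤ const190 bB.κ bN.κ b3.κ BG θW cΔ A₀ AH θD c :=
    const190_nonneg bB.κ_nonneg bN.κ_nonneg b3.κ_nonneg hc hBG hθW hcΔ hA₀ hAH hθD hq
  -- r08's end-to-end pair for each presentation; the block assignment `blk` of the OUTPUT sup sizes is immaterial (only their `loc`
  -- enters `Ineq190`/`hmv` and the conclusion), so the constant assignment to `y` is used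
  obtain ⟨h0, hmv0⟩ := ineq190_and_hmv_supSize_sectG (box := box₀) (blk := fun _ => y) R hWa H hTm hTm0 hB ev₀ hev₀ hN hBloc htri
    hd hδ₀ hrow8 hc hBG hθW hcΔ hA₀ hAH hθD hG hD2H0 hH0 hH h189 hDfr hq
    (fun B' => fun x => ev₀ x (chartH179 𝒢 W D2 H₀ (fun Y : 𝒴 => Y - H (D Y)) ε₄ B'))
    (fun t => (LinearMap.pi fun x => ((ev₀ x : 𝒴 →L[ℝ] E₀) : 𝒴 →ₗ[ℝ] E₀)) ∘ₗ
      ((fderiv ℂ (chartH179 𝒢 W D2 H₀ (fun Y : 𝒴 => Y - H (D Y)) ε₄) ((t : ℝ) • B)).restrictScalars ℝ : 𝒳 →ₗ[ℝ] 𝒴))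
    (fun _ => rfl) (fun _ => rfl) y
  obtain ⟨h1, hmv1⟩ := ineq190_and_hmv_supSize_sectG (box := box₁) (blk := fun _ => y) R hWa H hTm hTm0 hB ev₁ hev₁ hN hBloc htri
    hd hδ₀ hrow8 hc hBG hθW hcΔ hA₀ hAH hθD hG hD2H0 hH0 hH h189 hDfr hq
    (fun B' => fun i => ev₁ i (chartH179 𝒢 W D2 H₀ (fun Y : 𝒴 => Y - H (D Y)) ε₄ B'))
    (fun t => (LinearMap.pi fun i => ((ev₁ i : 𝒴 →L[ℝ] E₁) : 𝒴 →ₗ[ℝ] E₁)) ∘ₗ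
      ((fderiv ℂ (chartH179 𝒢 W D2 H₀ (fun Y : 𝒴 => Y - H (D Y)) ε₄) ((t : ℝ) • B)).restrictScalars ℝ : 𝒳 →ₗ[ℝ] 𝒴))
    (fun _ => rfl) (fun _ => rfl) y
  exact ineq123_of_ineq190₂ h0 h1 hK hK hd hrow hτ hστ B y hm hD hmv0 hmv1 hgeom hCB₀ hCB₁ hB₃ hLjη hεk hβ hεh hNR
    (norm_apply_le_loc hx fun x => ev₀ x (chartH179 𝒢 W D2 H₀ (fun Y : 𝒴 => Y - H (D Y)) ε₄ B))
    (norm_apply_le_loc hi fun i => ev₁ i (chartH179 𝒢 W D2 H₀ (fun Y : 𝒴 => Y - H (D Y)) ε₄ B))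

end SectG

end Literature.MathematicalPhysics.QuantumFieldTheory.Balaban1983to89.B16Ineq123From190
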